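import Summits.BirchSwinnertonDyer.Rank1Residual.X5.TwoAdicTargets
import Summits.BirchSwinnertonDyer.Rank1Residual.X11b.FrobeniusTraceMultiplicative
import Literature.NumberTheory.EllipticCurves.KatoRankBoundProofs
import Literature.NumberTheory.EllipticCurves.IwasawaSelmerDualProofs
import Literature.NumberTheory.EllipticCurves.CyclotomicIwasawaMainTheoremIrreducibleProofs
-- ENVIRONMENT PARITY (import refactor H2, 2026-08-26): the route-free modules that the dropped import
-- `…Theorems.PAdicOrderThesisR2.Negative.AtEveryGoodPrimeFalse` used to supply TRANSITIVELY (via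
-- `Theses.PAdicOrderV2` / `Theses.PAdicOrder` / `Theorems.PAdicOrderExistsOrdinary`) are imported here explicitly, so
-- that the ≈ 3 850 modules downstream of this hub lose ONLY the four route-side modules (whose names none of them
-- uses) and the declaration-free re-export `Summits.BirchSwinnertonDyer.Statement`.
import Mathlib
import Literature.NumberTheory.EllipticCurves.PAdicLFunction
import Literature.NumberTheory.EllipticCurves.PAdicBSD
import Literature.NumberTheory.EllipticCurves.BSDAnalyticRankTunnellCMProofs
import Literature.NumberTheory.EllipticCurves.OrdinaryPrimesProofs
import Literature.NumberTheory.EllipticCurves.GlobalMinimalModelProofs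
import Literature.NumberTheory.EllipticCurves.MinimalModelReduction
import Literature.NumberTheory.EllipticCurves.VariableChangePoints
import Literature.NumberTheory.EllipticCurves.IwasawaSelmer
import Literature.NumberTheory.EllipticCurves.BSDInvariantsProofs
import Literature.NumberTheory.EllipticCurves.CanonicalPAdicHeight
import Literature.NumberTheory.DiophantineGeometry.LocalReductionProofs
import Literature.NumberTheory.DiophantineGeometry.MinimalModelUniquenessProofs
import HarnessLib.Audit
import HarnessLib

/-!
# O1 (X5 at `p = 2`) — REFUTER junk pass on `X5/TwoAdicTargets.lean` (p249352)

(Authored by the o1 refuter seat, gen 2 — `refuter-b2b-bsdres-o1-refuter-g2-0`, REFUTER-O1.md §7.1,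
file `HOME/b2b-bsdres-o1-refuter/TwoAdicTargetsJunk.lean`, sha16 a710ddd858245933 —; filed
verbatim by the O1 typer cc-typer-4 at the refuter's request (the gate does not accept proposals
from the refuter role in the cell tree). The repaired, guarded item is
`O1.MainConjectureLowerDivisibilityAtTwoOrd` in `X5/TwoAdicTargetsMC.lean`; the original def stays
(Theorems files are append-only) and is equivalent to the guarded one off the additive cell,
`mainConjectureLowerDivisibilityAtTwo_iff_ord_of_not_cellAddv` there.)

HONEST FRAMING (cell rule, verbatim): 'prove what is provable now; shrink each hard class to its
core with data; no claim beyond stated classes'. O1 is OPEN; this file asserts nothing about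
`BSD(E,2)`. It records two STATEMENT-LEVEL defects found by the refuter seat (team O1, gen 2), both
rooted in the tree's junk value `unitRoot W p = 0` off the good-ordinary locus:

1. (tree: `unitRoot_eq_zero_of_dvd`) if `p ∣ a_p(W)` then `X² - a_p X + p` has no unit
   root in `ℤ_p` (a unit `α` would give `α² = a_p α - p ∈ pℤ_p`), so `unitRoot W p = 0`; and the
   Mazur–Swinnerton-Dyer / Mazur–Tate–Teitelbaum power series at the junk root is identically `0`
   (`padicLFunction_zero`: every Riemann sum uses level `n + e₀ ≥ 1`, where
   `μ_{f,0} = 0⁻¹ · … = 0`). At `p = 2` this is the case on the sub-cells `CellGoodSS`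
   (`2 ∣ a₂` by definition), `CellMultSplit` (tree convention `frobeniusTrace = 2`) and
   `CellMultNonsplit` (`frobeniusTrace = 0`) — 763 + 703 + 1 273 = 2 739 of the 5 295 residue
   classes (cell anatomy TSV; EVIDENCE, not a Literature fact).
2. Consequently `O1.MainConjectureLowerDivisibilityAtTwo W` — the "irreducible residue" labelled
   `@[conjecture]`, "NOTHING in print at `p = 2`", stated with **no `IsOrdinaryAt W 2` guard** —
   HOLDS TRIVIALLY there (`g = 0 ∈ char X`, `ι 0 = 0 = ϖ · L₂(f, 0, T)`):
   `mainConjectureLowerDivisibilityAtTwo_of_cellGoodSS / _of_cellMultSplit / _of_cellMultNonsplit`.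
   Refuter class: MISSTATED (not false). Repaired statement `C′` = the same body behind
   `IsOrdinaryAt W 2 →`; the witness `g = 0` does not bite `C′`.
3. Worse, the cell's unguarded `MazurMainConjecture W p` (`Rank1ResidualX1Defs`) is **FALSE** at
   every prime with `p ∣ a_p(W)` (`not_mazurMainConjecture_of_dvd_frobeniusTrace`): its conclusion
   `char X = (g)` with `ι g = ϖ · L_p(f, 0) = 0` forces `char X = ⊥`, while the tree's characteristic
   ideal of ANY module over the domain `Λ` is `≠ ⊥` (`Module.charIdeal_ne_bot`). The refutation is
   modulo two existence inputs only — modularity (`exists_isNewformOf`, a registered fact) and the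
   commensurability `Ω_E ∈ ℚ·Ω⁺_f` of the Néron and newform periods (inline hypothesis) — the
   cyclotomic datum and the dual `X(E/ℚ_∞)` being tree THEOREMS
   (`exists_isCyclotomic_isTopGenerator_isCyclotomicVariable_holds`, `nonempty_selmerDualData_holds`).
   Hence `mainConjectureLowerDivisibilityAtTwo_of_mazurMainConjecture` is VACUOUS on 2 739 cells and
   any future `MazurMainConjecture W 2 → …` item must carry `IsOrdinaryAt W 2` (PLAN v2 T2 already
   restricts to good-ordinary `2` in prose; the Lean predicate does not).
(On `CellAddv`, `frobeniusTrace = 1` and a spurious unit root of `X² - X + 2` exists; the value of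
`padicLFunction` there is unknown junk — neither proved nor refuted here.)

## Main statements

* `unitRoot_two_eq_zero_of_two_dvd_frobeniusTrace` (from the tree's `unitRoot_eq_zero_of_dvd`;
  the vanishing `padicLFunction f 0 = 0` is the tree's `padicLFunction_zero`).
* `mainConjectureLowerDivisibilityAtTwo_of_two_dvd_frobeniusTrace` + the three cell corollaries +
  `mainConjectureLowerDivisibilityAtTwo_of_not_goodOrd_of_not_addv`.
* `not_mazurMainConjecture_of_dvd_frobeniusTrace` (any `p`) and `not_mazurMainConjecture_two_of_…`
  for the three cells.

References: Mazur–Tate–Teitelbaum, Invent. Math. 84 (1986), §I.10–I.13 (the measure `μ_{f,α}`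
needs an allowable root `α ≠ 0`) [MazurTateTeitelbaum1986Invent]; Greenberg, LNM 1716 (1999), §1
Thm. 1.7 (supersingular: `X` is not `Λ`-torsion) [GreenbergLNM1716]; Silverman, *AEC* 2nd ed.,
Ex. 3.5 / V.4 [SilvermanAEC2009].
-/

noncomputable section

open scoped Classical MatrixGroups ModularForm

open Filter Topology CongruenceSubgroup WeierstrassCurve Literature.NumberTheory.EllipticCurves
  Literature.NumberTheory.EllipticCurves.ModularForms Literature.NumberTheory.EllipticCurves.Rank1Residual
  Literature.NumberTheory.EllipticCurves.Rank1Residual.Typed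
  Summit.BirchSwinnertonDyer.BirchSwinnertonDyer.Theorems.Rank1ResidualX1Defs
  Summit.BirchSwinnertonDyer.Rank1Residual.X11b.LocalTorsion

set_option autoImplicit false

namespace Summit.BirchSwinnertonDyer.Rank1Residual.X5.O1

/-! ## The junk root — PRIVATE verbatim copies of the tree lemmas (import refactor H2, 2026-08-26)

The vanishing of the Mazur–Swinnerton-Dyer objects at the junk root `α = 0`
(`padicLRiemannSum_zero`, `padicLCoeff_zero`, `padicLFunction_zero`) and `unitRoot W p = 0` for
`p ∣ a_p(W)` (`unitRoot_eq_zero_of_dvd`, via `not_isUnit_root_of_dvd`) are tree theorems of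
`Theorems/PAdicOrderThesisR2/Negative/AtEveryGoodPrimeFalse.lean` (namespace
`Summit.BirchSwinnertonDyer.BirchSwinnertonDyer.Theorems.PAdicOrderThesisR2.Negative`), which stays their
PUBLIC home. That file imports the ROUTE file `Theses.PAdicOrderV2`, and the standing build rule
(2026-08-26: only an item closer may import a `…Theses.<Route>` file) forbids this certificate hub
(≈ 3 850 importers) from importing it; the gate's single-home rule (`dedup.landed`) forbids a second
public copy. Hence the seven lemmas this file's proofs use are restated here as `private` theorems —
same short names, statements and proofs BYTE-IDENTICAL to the tree's (so every proof script below is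
unchanged) — and nothing outside this module can see or cite them. -/

section JunkRootPrivate

variable {N : ℕ} (f : CuspForm (Gamma0 N) 2) {p : ℕ} [Fact p.Prime]

/-- (private copy of `…PAdicOrderThesisR2.Negative.msdMeasure_zero_of_pos`) At the root `α = 0`
every value of the MSD measure `μ_{f,α}(a + p^m ℤ_p)` at positive level `m` vanishes
(Mazur–Tate–Teitelbaum 1986, §I.10 (10.1), read at the tree's junk root).
[cite: MazurTateTeitelbaum1986Invent, §I.10 (10.1)] -/
private theorem msdMeasure_zero_of_pos {m : ℕ} (hm : 0 < m) (a : ZMod (p ^ m)) :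
    msdMeasure f (0 : ℚ_[p]) m a = 0 := by
  obtain ⟨m, rfl⟩ := Nat.exists_eq_add_one_of_ne_zero hm.ne'
  simp [msdMeasure]

omit [Fact p.Prime] in
/-- (private copy of `…Negative.cyclotomicExponent_pos`) The cyclotomic exponent `e₀` is positive.
[cite: MazurTateTeitelbaum1986Invent, §I.13] -/
private theorem cyclotomicExponent_pos : 0 < cyclotomicExponent p := by
  unfold cyclotomicExponent
  split <;> omega

/-- (private copy of `…Negative.padicLRiemannSum_zero`) At `α = 0` every Riemann sum of every
coefficient of `L_p(f, α, T)` is `0`. [folklore] -/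
private theorem padicLRiemannSum_zero (k n : ℕ) : padicLRiemannSum f (0 : ℚ_[p]) k n = 0 := by
  unfold padicLRiemannSum
  simp only [msdMeasure_zero_of_pos f (Nat.add_pos_right n cyclotomicExponent_pos), zero_mul,
    Finset.sum_const_zero, finsum_zero]

/-- (private copy of `…Negative.padicLCoeff_zero`) At `α = 0` every coefficient of `L_p(f, α, T)`
is `0`. [folklore] -/
private theorem padicLCoeff_zero (k : ℕ) : padicLCoeff f (0 : ℚ_[p]) k = 0 := by
  unfold padicLCoeff
  have h : padicLRiemannSum f (0 : ℚ_[p]) k = fun _ => 0 := funext (padicLRiemannSum_zero f k)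
  rw [h]
  exact tendsto_const_nhds.limUnder_eq

/-- (private copy of `…Negative.padicLFunction_zero`) **`L_p(f, 0, T) = 0`** at the junk root
`α = 0`, for every cusp form `f ∈ S_2(Γ₀(N))` and every prime `p` (Mazur–Tate–Teitelbaum 1986,
§I.11: the construction is only meant for an allowable root `α ≠ 0`).
[cite: MazurTateTeitelbaum1986Invent, §I.11 (allowable root)] -/
private theorem padicLFunction_zero : padicLFunction f (0 : ℚ_[p]) = 0 := by
  ext k
  simp [padicLCoeff_zero]

end JunkRootPrivate

section NoUnitRootPrivate

variable (W : WeierstrassCurve ℚ) [W.IsGloballyMinimal] (p : ℕ) [Fact p.Prime]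

/-- (private copy of `…Negative.not_isUnit_root_of_dvd`) If `p ∣ a_p(W)` then no root `α ∈ ℤ_p`
of `X² - a_p X + p` is a unit (Mazur–Tate–Teitelbaum 1986, §I.11; Silverman AEC V, Ex. 5.10(a)).
[cite: MazurTateTeitelbaum1986Invent, §I.11 (allowable root)] -/
private theorem not_isUnit_root_of_dvd (h : (p : ℤ) ∣ W.frobeniusTrace p) {α : ℤ_[p]}
    (hα : α ^ 2 - (W.frobeniusTrace p : ℤ_[p]) * α + p = 0) : ¬ IsUnit α := by
  intro hu
  have hap : PadicInt.toZMod (W.frobeniusTrace p : ℤ_[p]) = 0 := by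
    rw [map_intCast, ZMod.intCast_zmod_eq_zero_iff_dvd]
    exact h
  have hp0 : PadicInt.toZMod (p : ℤ_[p]) = 0 := by
    rw [map_natCast, ZMod.natCast_self]
  have h2 := congrArg (PadicInt.toZMod (p := p)) hα
  rw [map_add, map_sub, map_mul, map_pow, hap, hp0, zero_mul, sub_zero, add_zero, map_zero] at h2
  exact (hu.map PadicInt.toZMod).ne_zero ((pow_eq_zero_iff two_ne_zero).mp h2)

/-- (private copy of `…Negative.unitRoot_eq_zero_of_dvd`) **`unitRoot W p = 0` whenever
`p ∣ a_p(W)`**: there is no unit root, so the tree's `unitRoot` takes its `dif_neg` junk value `0`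
(Mazur–Tate–Teitelbaum 1986, §I.11). [cite: MazurTateTeitelbaum1986Invent, §I.11 (allowable root)] -/
private theorem unitRoot_eq_zero_of_dvd (h : (p : ℤ) ∣ W.frobeniusTrace p) : unitRoot W p = 0 := by
  classical
  unfold unitRoot
  rw [dif_neg]
  rintro ⟨α, ⟨hα, hu⟩, -⟩
  exact not_isUnit_root_of_dvd W p h hα hu

end NoUnitRootPrivate

/-! ## `unitRoot W p` is junk (`= 0`) whenever `p ∣ a_p(W)` -/

variable (W : WeierstrassCurve ℚ) [W.IsElliptic] [W.IsGloballyMinimal]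

omit [W.IsElliptic] in
/-- The case `p = 2`: `2 ∣ a₂(W) → unitRoot W 2 = 0`. [folklore] -/
theorem unitRoot_two_eq_zero_of_two_dvd_frobeniusTrace (h : (2 : ℤ) ∣ W.frobeniusTrace 2) :
    unitRoot W 2 = 0 :=
  unitRoot_eq_zero_of_dvd W 2 (by exact_mod_cast h)

/-! ## The `@[conjecture]` item holds trivially off the good-ordinary cell -/

omit [W.IsElliptic] in
/-- **JUNK THEOREM.** `O1.MainConjectureLowerDivisibilityAtTwo W` — stated with no
`IsOrdinaryAt W 2` guard — holds for the trivial reason `g = 0 ∈ char X`, `ι 0 = 0 = ϖ · L₂(f, 0, T)`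
whenever `2 ∣ a₂(W)`. Refuter class: MISSTATED; repair = prepend `IsOrdinaryAt W 2 →`.
[folklore] -/
theorem mainConjectureLowerDivisibilityAtTwo_of_two_dvd_frobeniusTrace
    (h : (2 : ℤ) ∣ W.frobeniusTrace 2) : MainConjectureLowerDivisibilityAtTwo W := by
  intro κ γ _ _ _ _ f _ ϖ _ D
  refine ⟨0, Submodule.zero_mem _, ?_⟩
  rw [map_zero, unitRoot_two_eq_zero_of_two_dvd_frobeniusTrace W h, PadicInt.coe_zero,
    padicLFunction_zero, mul_zero]

omit [W.IsElliptic] in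
/-- On the good SUPERSINGULAR sub-cell `CellGoodSS W` (`2 ∣ a₂` by definition) the conjecture item
holds trivially. [folklore] -/
theorem mainConjectureLowerDivisibilityAtTwo_of_cellGoodSS (h : CellGoodSS W) :
    MainConjectureLowerDivisibilityAtTwo W :=
  mainConjectureLowerDivisibilityAtTwo_of_two_dvd_frobeniusTrace W h.2

/-- On the SPLIT multiplicative sub-cell `CellMultSplit W` (`frobeniusTrace W 2 = 2`,
`frobeniusTrace_eq_two_of_split`) the conjecture item holds trivially.
[cite: SilvermanAEC2009, Exercise 3.5 (PDF p. 97)] -/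
theorem mainConjectureLowerDivisibilityAtTwo_of_cellMultSplit (h : CellMultSplit W) :
    MainConjectureLowerDivisibilityAtTwo W :=
  mainConjectureLowerDivisibilityAtTwo_of_two_dvd_frobeniusTrace W
    (by rw [frobeniusTrace_eq_two_of_split W 2 h.hasMultiplicativeReductionAtPrime h])

/-- On the NONSPLIT multiplicative sub-cell `CellMultNonsplit W` (`frobeniusTrace W 2 = 0`,
`frobeniusTrace_eq_zero_of_nonsplit`) the conjecture item holds trivially.
[cite: SilvermanAEC2009, Exercise 3.5 (PDF p. 97)] -/
theorem mainConjectureLowerDivisibilityAtTwo_of_cellMultNonsplit (h : CellMultNonsplit W) :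
    MainConjectureLowerDivisibilityAtTwo W :=
  mainConjectureLowerDivisibilityAtTwo_of_two_dvd_frobeniusTrace W
    (by rw [frobeniusTrace_eq_zero_of_nonsplit W 2 h.1 h.2]; exact dvd_zero 2)

/-- Packaging: off the good-ordinary and additive cells the item is settled by junk — it carries
content ONLY on `CellGoodOrd W` (where `unitRoot W 2 ∈ ℤ₂ˣ`) and is of unknown junk status on
`CellAddv W`. [folklore] -/
theorem mainConjectureLowerDivisibilityAtTwo_of_not_goodOrd_of_not_addv
    (hgo : ¬ CellGoodOrd W) (had : ¬ CellAddv W) : MainConjectureLowerDivisibilityAtTwo W := by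
  rcases cells_exhaustive W with h | h | h | h | h
  · exact absurd h hgo
  · exact mainConjectureLowerDivisibilityAtTwo_of_cellGoodSS W h
  · exact mainConjectureLowerDivisibilityAtTwo_of_cellMultSplit W h
  · exact mainConjectureLowerDivisibilityAtTwo_of_cellMultNonsplit W h
  · exact absurd h had

/-! ## The unguarded `MazurMainConjecture W p` is FALSE whenever `p ∣ a_p(W)` -/

/-- **NEGATIVE LEMMA.** If `p ∣ a_p(W)` (e.g. `p` supersingular; at `p = 2` also multiplicative),
then the cell's `MazurMainConjecture W p` — stated with no ordinarity guard — is FALSE: its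
conclusion `char X = (g)`, `ι g = ϖ · L_p(f, unitRoot) = ϖ · L_p(f, 0) = 0` forces `g = 0`
(`ι` injective) and `char X = ⊥`, contradicting `Module.charIdeal_ne_bot` (the tree's
characteristic ideal of any `Λ`-module is nonzero). Inputs: the cyclotomic datum
(`exists_isCyclotomic_isTopGenerator_isCyclotomicVariable_holds`) and the dual `X(E/ℚ_∞)`
(`nonempty_selmerDualData_holds`) are tree theorems; modularity (`exists_isNewformOf`, registered
fact) and the period commensurability `Ω_E ∈ ℚ · Ω⁺_f` (hypothesis `hper`; Edixhoven 1991 Prop. 2 +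
isogeny lattice index — true for every `E/ℚ`, not registered at this generality) are hypotheses.
Consequence for O1: `mainConjectureLowerDivisibilityAtTwo_of_mazurMainConjecture` is VACUOUS on
`CellGoodSS ∪ CellMultSplit ∪ CellMultNonsplit`, and every future `MazurMainConjecture W 2 → …`
item must carry `IsOrdinaryAt W 2`. (Compare Greenberg 1999 Thm. 1.7: at supersingular `p` the
honest `X` is not even `Λ`-torsion — `SelmerDualData.not_isTorsion_of_supersingular`.)
[cite: GreenbergLNM1716, §1 Thm. 1.7 (pp. 61–62)] -/
theorem not_mazurMainConjecture_of_dvd_frobeniusTrace (p : ℕ) [Fact p.Prime]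
    (h : (p : ℤ) ∣ W.frobeniusTrace p) (hmod : exists_isNewformOf)
    (hper : ∀ [NeZero (W.conductorNorm ℤ)] (f : CuspForm (Gamma0 (W.conductorNorm ℤ)) 2),
      IsNewformOf W f → ∃ ϖ : ℚ, (ϖ : ℝ) * W.realPeriodRat = plusPeriod f) :
    ¬ MazurMainConjecture W p := by
  intro hMC
  haveI : NeZero (W.conductorNorm ℤ) := ⟨(W.conductorNorm_pos_holds).ne'⟩
  obtain ⟨κ, hκ, γ, hγ, hγ'⟩ := exists_isCyclotomic_isTopGenerator_isCyclotomicVariable_holds p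
  obtain ⟨f, hf⟩ := hmod W
  obtain ⟨ϖ, hϖ⟩ := hper f hf
  obtain ⟨D⟩ := W.nonempty_selmerDualData_holds κ γ hγ
  obtain ⟨-, g, hchar, hι⟩ := hMC κ γ hκ hγ hγ' f hf ϖ hϖ D
  rw [unitRoot_eq_zero_of_dvd W p h, PadicInt.coe_zero, padicLFunction_zero,
    mul_zero, ← map_zero (iwasawaToPowerSeries p)] at hι
  have hg : g = 0 := iwasawaToPowerSeries_injective p hι
  rw [hg, Ideal.span_singleton_eq_bot.mpr rfl] at hchar
  exact Module.charIdeal_ne_bot (IwasawaAlgebra p) D.X hchar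

/-- `MazurMainConjecture W 2` is false on the good SUPERSINGULAR cell at `2` (modulo modularity and
period commensurability). [cite: GreenbergLNM1716, §1 Thm. 1.7 (pp. 61–62)] -/
theorem not_mazurMainConjecture_two_of_cellGoodSS (h : CellGoodSS W) (hmod : exists_isNewformOf)
    (hper : ∀ [NeZero (W.conductorNorm ℤ)] (f : CuspForm (Gamma0 (W.conductorNorm ℤ)) 2),
      IsNewformOf W f → ∃ ϖ : ℚ, (ϖ : ℝ) * W.realPeriodRat = plusPeriod f) :
    ¬ MazurMainConjecture W 2 :=
  not_mazurMainConjecture_of_dvd_frobeniusTrace W 2 (by exact_mod_cast h.2) hmod hper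

/-- `MazurMainConjecture W 2` is false on the SPLIT multiplicative cell at `2` (same inputs).
[cite: SilvermanAEC2009, Exercise 3.5 (PDF p. 97)] -/
theorem not_mazurMainConjecture_two_of_cellMultSplit (h : CellMultSplit W)
    (hmod : exists_isNewformOf)
    (hper : ∀ [NeZero (W.conductorNorm ℤ)] (f : CuspForm (Gamma0 (W.conductorNorm ℤ)) 2),
      IsNewformOf W f → ∃ ϖ : ℚ, (ϖ : ℝ) * W.realPeriodRat = plusPeriod f) :
    ¬ MazurMainConjecture W 2 :=
  not_mazurMainConjecture_of_dvd_frobeniusTrace W 2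
    (by rw [frobeniusTrace_eq_two_of_split W 2 h.hasMultiplicativeReductionAtPrime h]; norm_num)
    hmod hper

/-- `MazurMainConjecture W 2` is false on the NONSPLIT multiplicative cell at `2` (same inputs).
[cite: SilvermanAEC2009, Exercise 3.5 (PDF p. 97)] -/
theorem not_mazurMainConjecture_two_of_cellMultNonsplit (h : CellMultNonsplit W)
    (hmod : exists_isNewformOf)
    (hper : ∀ [NeZero (W.conductorNorm ℤ)] (f : CuspForm (Gamma0 (W.conductorNorm ℤ)) 2),
      IsNewformOf W f → ∃ ϖ : ℚ, (ϖ : ℝ) * W.realPeriodRat = plusPeriod f) :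
    ¬ MazurMainConjecture W 2 :=
  not_mazurMainConjecture_of_dvd_frobeniusTrace W 2
    (by rw [frobeniusTrace_eq_zero_of_nonsplit W 2 h.1 h.2]; norm_num) hmod hper

end Summit.BirchSwinnertonDyer.Rank1Residual.X5.O1

end
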